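import Summits.Ventures.PercRepro.C026CutVertex
import Summits.Ventures.PercRepro.C026ProdCFEvents

/-!
# THEOREM PROD-CF, the graph half (2): the gluing dictionary (p5, gen 16)

For p6's 3-terminal gluing `IsGluing a b c side` of a marked multigraph `G` into the parts
`G.part side true`, `G.part side false` at the marks, each of the six events of
`C026ProdCFEvents` holds in `G` iff it holds in BOTH parts:

* `connAvoid_iff_exists_part` — **the no-mixing lemma for AVOIDING walks** (p6's
  `conn_iff_exists_part` with a forbidden vertex set: a walk changes colour only at a mark);
* `isoMark_gluing_iff` — «`m` iso» is part-wise;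
* `conn_compl_c_iff_exists_part`, `not_conn_compl_c_of_hasCol`,
  `connAvoid_of_part_of_not_conn_compl` — the closed `c`-cluster of `G` against those of the parts
  when no part closed-joins `c` to `a` or `b`;
* **`apart_gluing_iff`** — `Apart` is part-wise (both closed conditions and «every open `a`–`b`
  walk meets `D`»).

With p6's `isBot_gluing_iff` these make the six counts multiply (`C026ProdCFGluing`).
-/

namespace PercRepro

open Finset

namespace MultiGraph

section ProdCFGluingDict

variable {V E : Type*} {G : MultiGraph V E}

/-- Avoiding a larger set avoids a smaller one. -/
theorem ConnAvoid.mono_set {ω : Config E} {X Y : Set V} (hXY : X ⊆ Y) {u v : V}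
    (h : G.ConnAvoid ω Y u v) : G.ConnAvoid ω X u v := by
  unfold ConnAvoid at h ⊢
  induction h with
  | refl => exact Relation.ReflTransGen.refl
  | tail _ hxy ih =>
    exact ih.tail ⟨hxy.1, fun hx => hxy.2.1 (hXY hx), fun hy => hxy.2.2 (hXY hy)⟩

/-- An avoiding walk of a part is an avoiding walk of `G`. -/
theorem ConnAvoid.of_part {side : E → Bool} {s : Bool} {ω : Config E} {X : Set V} {u v : V}
    (h : (G.part side s).ConnAvoid (sideRestrict ω side s) X u v) : G.ConnAvoid ω X u v := by
  unfold ConnAvoid at h ⊢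
  induction h with
  | refl => exact Relation.ReflTransGen.refl
  | tail _ hxy ih => exact ih.tail ⟨OpenAdj.of_part hxy.1, hxy.2.1, hxy.2.2⟩

/-- **The no-mixing lemma for avoiding walks** (p6's `conn_iff_exists_part` with a forbidden set):
if no part joins `u` to a mark other than `u` by a walk avoiding `X`, then `G` joins `u` to `v`
avoiding `X` iff ONE part does — a walk changes colour only at a mark. -/
theorem connAvoid_iff_exists_part {a b c : V} {side : E → Bool} (hg : G.IsGluing a b c side)
    {ω : Config E} {X : Set V} {u : V}
    (hmk : ∀ x, x ≠ u → (x = a ∨ x = b ∨ x = c) →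
      ∀ s, ¬ (G.part side s).ConnAvoid (sideRestrict ω side s) X u x) (v : V) :
    G.ConnAvoid ω X u v ↔ ∃ s, (G.part side s).ConnAvoid (sideRestrict ω side s) X u v := by
  constructor
  · intro h
    unfold ConnAvoid at h
    induction h with
    | refl => exact ⟨true, Relation.ReflTransGen.refl⟩
    | @tail x y _ hxy ih =>
      obtain ⟨s, hsx⟩ := ih
      obtain ⟨⟨e, he, hend⟩, hx, hy⟩ := hxy
      have hj : G.Joins e x y := hend
      by_cases hxu : x = u
      · subst hxu
        exact ⟨side e, Relation.ReflTransGen.single ⟨openAdj_part_of_open he hj, hx, hy⟩⟩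
      · have hx' : ¬ (x = a ∨ x = b ∨ x = c) := fun hm => hmk x hxu hm s hsx
        push Not at hx'
        have hcol : side e = s :=
          hg.eq_of_hasCol hx'.1 hx'.2.1 hx'.2.2 (HasCol.of_joins (side := side) hj).1
            (hasCol_of_conn_part hsx.conn hxu)
        exact ⟨s, hsx.tail ⟨⟨⟨e, hcol⟩, he, hj⟩, hx, hy⟩⟩
  · rintro ⟨s, h⟩
    exact h.of_part

/-- **`IsoMark` is part-wise**: a mark `m` is joined to no other mark in `G` iff it is joined to no
other mark in either part (`hcover`: `x, y` are the two marks other than `m`). -/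
theorem isoMark_gluing_iff {a b c : V} {side : E → Bool} (hg : G.IsGluing a b c side)
    (ω : Config E) {m x y : V} (hcover : ∀ w, (w = a ∨ w = b ∨ w = c) → w ≠ m → w = x ∨ w = y) :
    G.IsoMark ω m x y ↔
      (G.part side true).IsoMark (sideRestrict ω side true) m x y ∧
        (G.part side false).IsoMark (sideRestrict ω side false) m x y := by
  unfold IsoMark
  constructor
  · rintro ⟨hx, hy⟩
    exact ⟨⟨fun h => hx (Conn.of_part h), fun h => hy (Conn.of_part h)⟩,
      ⟨fun h => hx (Conn.of_part h), fun h => hy (Conn.of_part h)⟩⟩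
  · rintro ⟨h₁, h₀⟩
    have hmk : ∀ w, w ≠ m → (w = a ∨ w = b ∨ w = c) →
        ∀ s, ¬ (G.part side s).Conn (sideRestrict ω side s) m w := by
      intro w hwm hw s
      rcases hcover w hw hwm with rfl | rfl
      · cases s
        · exact h₀.1
        · exact h₁.1
      · cases s
        · exact h₀.2
        · exact h₁.2
    refine ⟨fun h => ?_, fun h => ?_⟩
    · obtain ⟨s, hs⟩ := (conn_iff_exists_part hg hmk x).mp h
      cases s
      · exact h₀.1 hs
      · exact h₁.1 hs
    · obtain ⟨s, hs⟩ := (conn_iff_exists_part hg hmk y).mp h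
      cases s
      · exact h₀.2 hs
      · exact h₁.2 hs

/-- If no part closed-joins `c` to `a` or to `b`, then `c` is closed-joined in `G` to `v` iff one
part is (the no-mixing lemma on the complement). -/
theorem conn_compl_c_iff_exists_part {a b c : V} {side : E → Bool} (hg : G.IsGluing a b c side)
    {ω : Config E} (hca : ∀ s, ¬ (G.part side s).Conn (sideRestrict ω side s)ᶜ c a)
    (hcb : ∀ s, ¬ (G.part side s).Conn (sideRestrict ω side s)ᶜ c b) (v : V) :
    G.Conn ωᶜ c v ↔ ∃ s, (G.part side s).Conn (sideRestrict ω side s)ᶜ c v := by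
  have hmk : ∀ x, x ≠ c → (x = a ∨ x = b ∨ x = c) →
      ∀ s, ¬ (G.part side s).Conn (sideRestrict ωᶜ side s) c x := by
    intro x hxc hx s
    rw [sideRestrict_compl]
    rcases hx with rfl | rfl | rfl
    · exact hca s
    · exact hcb s
    · exact absurd rfl hxc
  rw [conn_iff_exists_part hg hmk v]
  simp only [sideRestrict_compl]

/-- If no part closed-joins `c` to `a` or to `b`, a vertex carrying an edge of colour `s` that is
outside the closed `c`-cluster of the part of colour `s` is outside the closed `c`-cluster of `G`. -/
theorem not_conn_compl_c_of_hasCol {a b c : V} {side : E → Bool} (hg : G.IsGluing a b c side)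
    {ω : Config E} (hca : ∀ s, ¬ (G.part side s).Conn (sideRestrict ω side s)ᶜ c a)
    (hcb : ∀ s, ¬ (G.part side s).Conn (sideRestrict ω side s)ᶜ c b) {s : Bool} {v : V}
    (hv : G.HasCol side s v) (hvs : ¬ (G.part side s).Conn (sideRestrict ω side s)ᶜ c v) :
    ¬ G.Conn ωᶜ c v := by
  intro h
  obtain ⟨s', hs'⟩ := (conn_compl_c_iff_exists_part hg hca hcb v).mp h
  by_cases hvc : v = c
  · subst hvc
    exact hvs (Conn.refl _ _ _)
  by_cases hva : v = a
  · subst hva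
    exact hca s' hs'
  by_cases hvb : v = b
  · subst hvb
    exact hcb s' hs'
  -- `v` is a non-mark carrying a closed walk of colour `s'` and an edge of colour `s`
  have hv' : G.HasCol side s' v := by
    rw [← sideRestrict_compl] at hs'
    exact hasCol_of_conn_part hs' hvc
  have : s' = s := hg.eq_of_hasCol hva hvb hvc hv' hv
  subst this
  exact hvs hs'

/-- If no part closed-joins `c` to `a` or to `b`, an open walk of a part avoiding the part's closed
`c`-cluster avoids the closed `c`-cluster of `G` (every vertex of the walk carries an edge of the
part's colour). -/
theorem connAvoid_of_part_of_not_conn_compl {a b c : V} {side : E → Bool}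
    (hg : G.IsGluing a b c side) {ω : Config E}
    (hca : ∀ s, ¬ (G.part side s).Conn (sideRestrict ω side s)ᶜ c a)
    (hcb : ∀ s, ¬ (G.part side s).Conn (sideRestrict ω side s)ᶜ c b) {s : Bool} {u v : V}
    (h : (G.part side s).ConnAvoid (sideRestrict ω side s)
      ((G.part side s).cluster (sideRestrict ω side s)ᶜ c) u v) :
    G.ConnAvoid ω (G.cluster ωᶜ c) u v := by
  unfold ConnAvoid at h ⊢
  induction h with
  | refl => exact Relation.ReflTransGen.refl
  | @tail x y _ hxy ih =>
    obtain ⟨⟨e, he, hend⟩, hx, hy⟩ := hxy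
    have hj : G.Joins e.1 x y := hend
    have hcol := HasCol.of_joins (side := side) hj
    rw [e.2] at hcol
    refine ih.tail ⟨⟨e.1, he, hend⟩, ?_, ?_⟩
    · exact not_conn_compl_c_of_hasCol hg hca hcb hcol.1 hx
    · exact not_conn_compl_c_of_hasCol hg hca hcb hcol.2 hy

/-- **`Apart` is part-wise**: `Apart` holds in `G` iff it holds in both parts. -/
theorem apart_gluing_iff {a b c : V} {side : E → Bool} (hg : G.IsGluing a b c side)
    (ω : Config E) :
    G.Apart ω a b c ↔
      (G.part side true).Apart (sideRestrict ω side true) a b c ∧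
        (G.part side false).Apart (sideRestrict ω side false) a b c := by
  constructor
  · rintro ⟨hca, hcb, hav⟩
    -- the closed conditions pass to the parts; the avoiding walk of a part avoids `D_G`
    have hca' : ∀ s, ¬ (G.part side s).Conn (sideRestrict ω side s)ᶜ c a := by
      intro s h
      rw [← sideRestrict_compl] at h
      exact hca (Conn.of_part h)
    have hcb' : ∀ s, ¬ (G.part side s).Conn (sideRestrict ω side s)ᶜ c b := by
      intro s h
      rw [← sideRestrict_compl] at h
      exact hcb (Conn.of_part h)
    have hav' : ∀ s, ¬ (G.part side s).ConnAvoid (sideRestrict ω side s)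
        ((G.part side s).cluster (sideRestrict ω side s)ᶜ c) a b :=
      fun s h => hav (connAvoid_of_part_of_not_conn_compl hg hca' hcb' h)
    exact ⟨⟨hca' true, hcb' true, hav' true⟩, ⟨hca' false, hcb' false, hav' false⟩⟩
  · rintro ⟨⟨hca₁, hcb₁, hav₁⟩, ⟨hca₀, hcb₀, hav₀⟩⟩
    have hca' : ∀ s, ¬ (G.part side s).Conn (sideRestrict ω side s)ᶜ c a := by
      intro s
      cases s
      · exact hca₀
      · exact hca₁
    have hcb' : ∀ s, ¬ (G.part side s).Conn (sideRestrict ω side s)ᶜ c b := by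
      intro s
      cases s
      · exact hcb₀
      · exact hcb₁
    have hca : ¬ G.Conn ωᶜ c a := by
      intro h
      obtain ⟨s, hs⟩ := (conn_compl_c_iff_exists_part hg hca' hcb' a).mp h
      exact hca' s hs
    have hcb : ¬ G.Conn ωᶜ c b := by
      intro h
      obtain ⟨s, hs⟩ := (conn_compl_c_iff_exists_part hg hca' hcb' b).mp h
      exact hcb' s hs
    refine ⟨hca, hcb, fun hav => ?_⟩
    -- the closed `c`-cluster of a part is inside that of `G`
    have hsub : ∀ s, (G.part side s).cluster (sideRestrict ω side s)ᶜ c ⊆ G.cluster ωᶜ c := by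
      intro s
      rw [← sideRestrict_compl]
      exact cluster_part_subset side s ωᶜ c
    have hmk : ∀ x, x ≠ a → (x = a ∨ x = b ∨ x = c) →
        ∀ s, ¬ (G.part side s).ConnAvoid (sideRestrict ω side s) (G.cluster ωᶜ c) a x := by
      intro x hxa hx s h
      rcases hx with rfl | rfl | rfl
      · exact absurd rfl hxa
      · have h' := h.mono_set (hsub s)
        cases s
        · exact hav₀ h'
        · exact hav₁ h'
      · exact h.notMem_of_notMem hca (Conn.refl _ _ _)
    obtain ⟨s, hs⟩ := (connAvoid_iff_exists_part hg hmk b).mp hav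
    have h' := hs.mono_set (hsub s)
    cases s
    · exact hav₀ h'
    · exact hav₁ h'

end ProdCFGluingDict

end MultiGraph

end PercRepro
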